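import Mathlib
import HarnessLib
import Summits.Ventures.LatticeQCDFlow.Scoring.GeometricEnvelopeBlockSumLeadingBias

/-!
# DEGENERATE Green–Kubo variance: `σ²_f = 0` iff the centred observable is a one-step COBOUNDARY
# of the Poisson solution; then every centred block sum is `h(X_s) − h(X_{s+n})` almost surely, and the
# second moments of block sums are either uniformly bounded (`σ²_f = 0`) or grow linearly (`σ²_f > 0`)

HONEST FRAMING: exact (Metropolis-corrected) sampling algorithms for lattice gauge theory;
figures of merit are autocorrelation/cost numbers at stated couplings and volumes; no
continuum-physics claim.

Venture `LatticeQCDFlow` (cell pub-lqcd), topic `Scoring`; FANOUT row 8 (`s0-cpn-nemc`, GEN-23).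
NEW WORK of the cell, not a published result; no definition is introduced; nothing is cited as a
fact.  Every studentised CLT and exact-coverage theorem of the row (`Scoring/MarkovChainCLTStudentized`,
`Scoring/DoeblinPowerBatchMeansDeltaMethod`, `Scoring/RestartChainJarzynskiDeltaF`, …) ASSUMES a
positive Green–Kubo variance `σ²_f = ∫ f̄² dπ + 2 Σ' k, ∫ f̄ (kop κ)^[k+1] f̄ dπ` (`f̄ = f − πf`); row 13
showed that a one-step minorisation forces `σ²_f ≥ (e/(2e+4)) Var_π f`
(`Exactness/NCMCGeneralSpaceAsymptoticVarianceLowerBound`) and that under a mere Doeblin POWER a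
three-valued observable can have `Var_π f = 2/3` and `σ²_f = 0`
(`Exactness/NCMCGeneralSpaceAsymptoticVarianceCounterexample`).  THIS FILE settles WHEN the variance
degenerates, for every kernel with a geometric sup-norm envelope `|(kop κ)^[t] g − πg| ≤ 2 C_g A ρ^t`
(`0 ≤ ρ < 1`; every kernel with a Doeblin power, `Scoring/DoeblinPowerGeometricEnvelope`) and `π`
invariant.  With `h` ANY bounded measurable Poisson solution `h − kop κ h = f̄` (one exists with
`|h| ≤ 4CA/(1−ρ)`, `Scoring/GeometricEnvelopeBlockSumMoments.poisson_exists_of_geometricEnvelope`) and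
`q = kop κ (h²) − (kop κ h)²` its one-step conditional variance, `σ²_f = ∫ q dπ`
(`poisson_condVar_integral_eq_greenKubo_of_envelope`), and `q(x) = ∫ (h − kop κ h (x))² dκ(x, ·)`; so
`σ²_f = 0` iff `q = 0` `π`-a.e. iff for `π`-a.e. `x` the solution `h` is `κ(x, ·)`-a.s. EQUAL TO
`kop κ h (x) = h(x) − f̄(x)`: the centred observable at the current state is, almost surely, the drop of
`h` over the next step — a COBOUNDARY along the chain.  Along the path law `P_π` of the stationary chain
this says that every martingale increment `h(X_{t+1}) − kop κ h (X_t)` vanishes a.s. (its second moment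
IS `σ²_f`, at every `t`), hence by telescoping EVERY centred block sum is `h(X_s) − h(X_{s+n})` a.s. and
stays within `2‖h‖_∞` for all `s, n` simultaneously.  From an ARBITRARY start `μ₀` the increments'
second moments are `≤ 2 C_h² A ρ^t` (the envelope on `q`, `πq = 0`), so the block martingale has
`E_{μ₀}[M_{s,n}²] ≤ 2 C_h² A ρ^s/(1−ρ)` for every `n` (so the block sums have uniformly bounded second
moments from any start; the dichotomy with the linear growth at `σ²_f > 0` is the companion file
`Scoring/GreenKuboBlockSumDichotomy`).
Printed counterparts NAMED ONLY: the a.s. `o(√n)` statement for `V`-uniformly ergodic chains with null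
asymptotic variance (Meyn–Tweedie, *Markov Chains and Stochastic Stability*, Thm 17.5.4) and the
null-variance/coboundary equivalence for geometrically ergodic chains (Kontoyiannis–Meyn 2003,
Prop. 2.4); the zero-variance control variate `g − Pg` (Henderson–Glynn) — nothing is cited as a fact.

## Content (envelope `(A, ρ)`, `0 ≤ ρ < 1`, `π` invariant; `|f| ≤ C` measurable, `f̄ = f − πf`;
## `h` bounded measurable with `h − kop κ h = f̄`; `P_{μ₀}` the chain's path law from `μ₀`)

* `integral_sq_sub_kop_eq` — `∫ (h − kop κ h x)² dκ(x,·) = kop κ (h²) x − (kop κ h x)²`;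
  `kopCondVar_eq_zero_iff` — `… = 0 ↔ ∀ᵐ y ∂κ x, h y = kop κ h x`.
* **`greenKubo_eq_zero_iff_condVar_ae_eq_zero_of_envelope`** — `σ²_f = 0 ↔ q =ᵐ[π] 0`;
  **`greenKubo_eq_zero_iff_coboundary_of_envelope`** —
  `σ²_f = 0 ↔ ∀ᵐ x ∂π, ∀ᵐ y ∂(κ x), f x − πf = h x − h y`.
* `chain_incrementSq_eq_integral_iterate_kop` — `E_{μ₀}[(h(X_{t+1}) − kop κ h(X_t))²] = ∫ (kop κ)^[t] q dμ₀`;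
  **`chain_incrementSq_eq_greenKubo_of_envelope`** — `= σ²_f` under `P_π`, every `t`;
  **`abs_chain_incrementSq_sub_greenKubo_le_of_envelope`** — `|E_{μ₀}[…²] − σ²_f| ≤ 2 C_h² A ρ^t`.
* **`chain_increment_ae_eq_zero_of_greenKubo_eq_zero`**, **`chain_blockSum_ae_eq_of_greenKubo_eq_zero`**
  (`Σ_{t<n} f̄(X_{s+t}) = h(X_s) − h(X_{s+n})` `P_π`-a.s., all `s, n` at once),
  **`chain_blockSum_abs_le_ae_of_greenKubo_eq_zero`** (`|Σ_{t<n} f̄(X_{s+t})| ≤ 8CA/(1−ρ)` a.s., all `s, n`).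
* **`chain_blockMartingale_sq_le_of_greenKubo_eq_zero`** — `σ²_f = 0 ⇒ E_{μ₀}[M_{s,n}²] ≤ 2 C_h² A ρ^s/(1−ρ)`
  for EVERY `n`: from any start the block martingale of the Poisson solution is negligible.

NOT CLAIMED: the second-moment dichotomy of the block sums themselves (companion file
`Scoring/GreenKuboBlockSumDichotomy`); the value of the leading-bias constant `Γ_f` in the degenerate
case; reversible kernels (there `σ²_f = 0` forces `f̄ = 0` a.e.; not here); unbounded observables; any
`A, ρ` of a concrete sampler; any number of ours.
-/

noncomputable section

namespace Summit.Ventures.LatticeQCDFlow.Scoring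

open MeasureTheory ProbabilityTheory Filter Finset Preorder Literature.Probability.MarkovChains
open scoped ENNReal Topology

variable {Ω : Type*} [MeasurableSpace Ω]

/-! ### Kernel level: the conditional variance of an observable vanishes iff it is a.s. constant -/

section Kernel

variable (κ : Kernel Ω Ω) [IsMarkovKernel κ]

/-- `∫ (h y − kop κ h x)² dκ(x, ·) = kop κ (h²) x − (kop κ h x)²` for bounded measurable `h`. -/
theorem integral_sq_sub_kop_eq {h : Ω → ℝ} (hh : Measurable h) {Ch : ℝ} (hCh : ∀ x, |h x| ≤ Ch)
    (x : Ω) :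
    ∫ y, (h y - kop κ h x) ^ 2 ∂(κ x) = kop κ (fun y => h y ^ 2) x - (kop κ h x) ^ 2 := by
  set c := kop κ h x with hc
  have hi2 : Integrable (fun y => h y ^ 2) (κ x) :=
    integrable_of_bounded _ (hh.pow_const 2) (C := Ch ^ 2) fun y => by
      rw [abs_pow]; exact pow_le_pow_left₀ (abs_nonneg _) (hCh y) 2
  have hi1 : Integrable h (κ x) := integrable_of_bounded _ hh hCh
  have hexp : (fun y => (h y - c) ^ 2) = fun y => (h y ^ 2 - (2 * c) * h y) + c ^ 2 := by
    funext y; ring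
  have hiB : Integrable (fun y => (2 * c) * h y) (κ x) := hi1.const_mul (2 * c)
  have hiA : Integrable (fun y => h y ^ 2 - (2 * c) * h y) (κ x) := hi2.sub hiB
  rw [hexp, integral_add hiA (integrable_const _), integral_sub hi2 hiB, integral_const_mul,
    integral_const, probReal_univ, one_smul]
  have h1 : ∫ y, h y ∂(κ x) = c := rfl
  have h2 : ∫ y, h y ^ 2 ∂(κ x) = kop κ (fun y => h y ^ 2) x := rfl
  rw [h1, h2]
  ring

/-- **The one-step conditional variance vanishes at `x` iff `h` is `κ(x, ·)`-a.s. equal to its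
conditional mean**: `kop κ (h²) x − (kop κ h x)² = 0 ↔ ∀ᵐ y ∂(κ x), h y = kop κ h x`. -/
theorem kopCondVar_eq_zero_iff {h : Ω → ℝ} (hh : Measurable h) {Ch : ℝ} (hCh : ∀ x, |h x| ≤ Ch)
    (x : Ω) :
    kop κ (fun y => h y ^ 2) x - (kop κ h x) ^ 2 = 0 ↔ ∀ᵐ y ∂(κ x), h y = kop κ h x := by
  rw [← integral_sq_sub_kop_eq κ hh hCh x]
  have hCh0 : 0 ≤ Ch := (abs_nonneg _).trans (hCh x)
  have hi : Integrable (fun y => (h y - kop κ h x) ^ 2) (κ x) :=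
    integrable_of_bounded _ ((hh.sub_const _).pow_const 2) (C := (Ch + Ch) ^ 2) fun y => by
      rw [abs_pow]
      refine pow_le_pow_left₀ (abs_nonneg _) ((abs_sub _ _).trans ?_) 2
      exact add_le_add (hCh y) (abs_kop_le κ hCh x)
  rw [integral_eq_zero_iff_of_nonneg (fun y => sq_nonneg _) hi]
  exact ⟨fun h0 => h0.mono fun y hy => sub_eq_zero.1 (pow_eq_zero_iff two_ne_zero |>.1 hy),
    fun h0 => h0.mono fun y hy => by simp [hy]⟩

end Kernel

/-! ### `σ²_f = 0` iff the centred observable is a coboundary -/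

section Envelope

variable {κ : Kernel Ω Ω} [IsMarkovKernel κ] {π : Measure Ω} [IsProbabilityMeasure π] {A ρ : ℝ}

/-- **`σ²_f = 0 ↔ q = 0` `π`-a.e.**, `q = kop κ (h²) − (kop κ h)²` the one-step conditional variance of
ANY bounded measurable Poisson solution `h` (`h − kop κ h = f − πf`), under the envelope with `π`
invariant (`0 ≤ ρ < 1`). -/
theorem greenKubo_eq_zero_iff_condVar_ae_eq_zero_of_envelope (hπ : Kernel.Invariant κ π)
    (henv : ∀ (g : Ω → ℝ), Measurable g → ∀ (Cg : ℝ), (∀ x, |g x| ≤ Cg) →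
      ∀ (t : ℕ) (x : Ω), |(kop κ)^[t] g x - ∫ y, g y ∂π| ≤ 2 * Cg * (A * ρ ^ t))
    (hρ0 : 0 ≤ ρ) (hρ1 : ρ < 1)
    {f : Ω → ℝ} (hf : Measurable f) {C : ℝ} (hC : ∀ x, |f x| ≤ C)
    {h : Ω → ℝ} (hh : Measurable h) {Ch : ℝ} (hCh : ∀ x, |h x| ≤ Ch)
    (hpois : ∀ y, h y - kop κ h y = f y - ∫ z, f z ∂π) :
    (∫ y, (f y - ∫ z, f z ∂π) ^ 2 ∂π)
        + 2 * ∑' k, ∫ y, (f y - ∫ z, f z ∂π) * (kop κ)^[k + 1] (fun y => f y - ∫ z, f z ∂π) y ∂π = 0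
      ↔ (fun y => kop κ (fun z => h z ^ 2) y - (kop κ h y) ^ 2) =ᵐ[π] 0 := by
  rw [← poisson_condVar_integral_eq_greenKubo_of_envelope hπ henv hρ0 hρ1 hf hC hh hCh hpois]
  obtain ⟨hqm, hqb⟩ := kopCondVar_bounded_measurable κ hh hCh
  exact integral_eq_zero_iff_of_nonneg (fun y => kopCondVar_nonneg κ hh hCh y)
    (integrable_of_bounded π hqm hqb)

/-- **DEGENERATE VARIANCE IFF COBOUNDARY.**  Under the envelope with `π` invariant (`0 ≤ ρ < 1`),
`|f| ≤ C` measurable, and `h` ANY bounded measurable solution of `h − kop κ h = f − πf`: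
`σ²_f = 0 ↔ for π-a.e. x, for κ(x,·)-a.e. y, f x − πf = h x − h y` — the centred observable at the
current state is almost surely the drop of the Poisson solution over the next step. -/
theorem greenKubo_eq_zero_iff_coboundary_of_envelope (hπ : Kernel.Invariant κ π)
    (henv : ∀ (g : Ω → ℝ), Measurable g → ∀ (Cg : ℝ), (∀ x, |g x| ≤ Cg) →
      ∀ (t : ℕ) (x : Ω), |(kop κ)^[t] g x - ∫ y, g y ∂π| ≤ 2 * Cg * (A * ρ ^ t))
    (hρ0 : 0 ≤ ρ) (hρ1 : ρ < 1)
    {f : Ω → ℝ} (hf : Measurable f) {C : ℝ} (hC : ∀ x, |f x| ≤ C)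
    {h : Ω → ℝ} (hh : Measurable h) {Ch : ℝ} (hCh : ∀ x, |h x| ≤ Ch)
    (hpois : ∀ y, h y - kop κ h y = f y - ∫ z, f z ∂π) :
    (∫ y, (f y - ∫ z, f z ∂π) ^ 2 ∂π)
        + 2 * ∑' k, ∫ y, (f y - ∫ z, f z ∂π) * (kop κ)^[k + 1] (fun y => f y - ∫ z, f z ∂π) y ∂π = 0
      ↔ ∀ᵐ x ∂π, ∀ᵐ y ∂(κ x), f x - ∫ z, f z ∂π = h x - h y := by
  rw [greenKubo_eq_zero_iff_condVar_ae_eq_zero_of_envelope hπ henv hρ0 hρ1 hf hC hh hCh hpois]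
  refine ⟨fun h0 => h0.mono fun x hx => ?_, fun h0 => h0.mono fun x hx => ?_⟩
  · have hx' : kop κ (fun z => h z ^ 2) x - (kop κ h x) ^ 2 = 0 := hx
    refine ((kopCondVar_eq_zero_iff κ hh hCh x).1 hx').mono fun y hy => ?_
    rw [← hpois x, hy]
  · show kop κ (fun z => h z ^ 2) x - (kop κ h x) ^ 2 = 0
    refine (kopCondVar_eq_zero_iff κ hh hCh x).2 (hx.mono fun y hy => ?_)
    rw [← hpois x] at hy
    linarith

/-! ### Path space: the second moment of a martingale increment IS `σ²_f` -/

variable (κ) in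
omit [IsProbabilityMeasure π] in
/-- `E_{μ₀}[(h(X_{t+1}) − kop κ h(X_t))²] = ∫ (kop κ)^[t] (kop κ (h²) − (kop κ h)²) dμ₀` for every
initial law `μ₀`, every `t`, every bounded measurable `h`. -/
theorem chain_incrementSq_eq_integral_iterate_kop (μ₀ : Measure Ω) [IsProbabilityMeasure μ₀]
    {h : Ω → ℝ} (hh : Measurable h) {Ch : ℝ} (hCh : ∀ x, |h x| ≤ Ch) (t : ℕ) :
    ∫ x, (h (x (t + 1)) - kop κ h (x t)) ^ 2 ∂(Kernel.trajMeasure (X := fun _ : ℕ => Ω) μ₀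
        (fun n : ℕ => κ.comap (fun h : (i : ↥(Finset.Iic n)) → Ω => h ⟨n, Finset.mem_Iic.2 le_rfl⟩)
          (measurable_pi_apply _)))
      = ∫ x, (kop κ)^[t] (fun y => kop κ (fun z => h z ^ 2) y - (kop κ h y) ^ 2) x ∂μ₀ := by
  obtain ⟨hqm, hqb⟩ := kopCondVar_bounded_measurable κ hh hCh
  have key := chain_increment_sq κ μ₀ t (G := fun _ => (1 : ℝ)) measurable_const
    ((dependsOn_const (1 : ℝ)).mono (Set.empty_subset _)) (CG := 1) (fun _ => by simp) hh hCh
  simp only [one_mul] at key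
  rw [key, chain_expect κ μ₀ hqm hqb t]

/-- **Under `P_π` the second moment of every martingale increment of the Poisson solution IS the
Green–Kubo variance**: `E_π[(h(X_{t+1}) − kop κ h(X_t))²] = σ²_f` for every `t` (envelope, `π`
invariant, `0 ≤ ρ < 1`, `h − kop κ h = f − πf` bounded measurable). -/
theorem chain_incrementSq_eq_greenKubo_of_envelope (hπ : Kernel.Invariant κ π)
    (henv : ∀ (g : Ω → ℝ), Measurable g → ∀ (Cg : ℝ), (∀ x, |g x| ≤ Cg) →
      ∀ (t : ℕ) (x : Ω), |(kop κ)^[t] g x - ∫ y, g y ∂π| ≤ 2 * Cg * (A * ρ ^ t))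
    (hρ0 : 0 ≤ ρ) (hρ1 : ρ < 1)
    {f : Ω → ℝ} (hf : Measurable f) {C : ℝ} (hC : ∀ x, |f x| ≤ C)
    {h : Ω → ℝ} (hh : Measurable h) {Ch : ℝ} (hCh : ∀ x, |h x| ≤ Ch)
    (hpois : ∀ y, h y - kop κ h y = f y - ∫ z, f z ∂π) (t : ℕ) :
    ∫ x, (h (x (t + 1)) - kop κ h (x t)) ^ 2 ∂(Kernel.trajMeasure (X := fun _ : ℕ => Ω) π
        (fun n : ℕ => κ.comap (fun h : (i : ↥(Finset.Iic n)) → Ω => h ⟨n, Finset.mem_Iic.2 le_rfl⟩)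
          (measurable_pi_apply _)))
      = (∫ y, (f y - ∫ z, f z ∂π) ^ 2 ∂π)
        + 2 * ∑' k, ∫ y, (f y - ∫ z, f z ∂π) * (kop κ)^[k + 1] (fun y => f y - ∫ z, f z ∂π) y ∂π := by
  obtain ⟨hqm, hqb⟩ := kopCondVar_bounded_measurable κ hh hCh
  obtain ⟨hKqm, hKqb⟩ := iterate_kop_bounded_measurable κ hqm hqb t
  rw [chain_incrementSq_eq_integral_iterate_kop κ π hh hCh t, integral_iterate_kop κ hπ hqm hqb t,
    poisson_condVar_integral_eq_greenKubo_of_envelope hπ henv hρ0 hρ1 hf hC hh hCh hpois]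

/-- **From ANY start the increment's second moment is `σ²_f` up to a geometric transient**:
`|E_{μ₀}[(h(X_{t+1}) − kop κ h(X_t))²] − σ²_f| ≤ 2 C_h² A ρ^t`. -/
theorem abs_chain_incrementSq_sub_greenKubo_le_of_envelope (hπ : Kernel.Invariant κ π)
    (henv : ∀ (g : Ω → ℝ), Measurable g → ∀ (Cg : ℝ), (∀ x, |g x| ≤ Cg) →
      ∀ (t : ℕ) (x : Ω), |(kop κ)^[t] g x - ∫ y, g y ∂π| ≤ 2 * Cg * (A * ρ ^ t))
    (hρ0 : 0 ≤ ρ) (hρ1 : ρ < 1)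
    {f : Ω → ℝ} (hf : Measurable f) {C : ℝ} (hC : ∀ x, |f x| ≤ C)
    {h : Ω → ℝ} (hh : Measurable h) {Ch : ℝ} (hCh : ∀ x, |h x| ≤ Ch)
    (hpois : ∀ y, h y - kop κ h y = f y - ∫ z, f z ∂π)
    (μ₀ : Measure Ω) [IsProbabilityMeasure μ₀] (t : ℕ) :
    |∫ x, (h (x (t + 1)) - kop κ h (x t)) ^ 2 ∂(Kernel.trajMeasure (X := fun _ : ℕ => Ω) μ₀
        (fun n : ℕ => κ.comap (fun h : (i : ↥(Finset.Iic n)) → Ω => h ⟨n, Finset.mem_Iic.2 le_rfl⟩)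
          (measurable_pi_apply _)))
      - ((∫ y, (f y - ∫ z, f z ∂π) ^ 2 ∂π)
        + 2 * ∑' k, ∫ y, (f y - ∫ z, f z ∂π) * (kop κ)^[k + 1] (fun y => f y - ∫ z, f z ∂π) y ∂π)|
      ≤ 2 * Ch ^ 2 * (A * ρ ^ t) := by
  obtain ⟨hqm, hqb⟩ := kopCondVar_bounded_measurable κ hh hCh
  obtain ⟨hKqm, hKqb⟩ := iterate_kop_bounded_measurable κ hqm hqb t
  rw [chain_incrementSq_eq_integral_iterate_kop κ μ₀ hh hCh t,
    ← poisson_condVar_integral_eq_greenKubo_of_envelope hπ henv hρ0 hρ1 hf hC hh hCh hpois]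
  set q : Ω → ℝ := fun y => kop κ (fun z => h z ^ 2) y - (kop κ h y) ^ 2 with hq
  have hpt : ∀ x, |(kop κ)^[t] q x - ∫ y, q y ∂π| ≤ 2 * Ch ^ 2 * (A * ρ ^ t) := henv q hqm _ hqb t
  have hi : Integrable (fun x => (kop κ)^[t] q x - ∫ y, q y ∂π) μ₀ :=
    (integrable_of_bounded μ₀ hKqm hKqb).sub (integrable_const _)
  calc |∫ x, (kop κ)^[t] q x ∂μ₀ - ∫ y, q y ∂π|
      = |∫ x, ((kop κ)^[t] q x - ∫ y, q y ∂π) ∂μ₀| := by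
        rw [integral_sub (integrable_of_bounded μ₀ hKqm hKqb) (integrable_const _), integral_const,
          probReal_univ, one_smul]
    _ ≤ ∫ x, |(kop κ)^[t] q x - ∫ y, q y ∂π| ∂μ₀ := abs_integral_le_integral_abs
    _ ≤ ∫ x, 2 * Ch ^ 2 * (A * ρ ^ t) ∂μ₀ :=
        integral_mono hi.abs (integrable_const _) fun x => hpt x
    _ = 2 * Ch ^ 2 * (A * ρ ^ t) := by rw [integral_const, probReal_univ, one_smul]

/-! ### `σ²_f = 0`: the increments vanish and the block sums telescope, almost surely under `P_π` -/

/-- **`σ²_f = 0 ⇒` every martingale increment vanishes `P_π`-a.s.**, simultaneously for all `t`: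
`∀ᵐ x ∂P_π, ∀ t, h(x(t+1)) = kop κ h (x t)`. -/
theorem chain_increment_ae_eq_zero_of_greenKubo_eq_zero (hπ : Kernel.Invariant κ π)
    (henv : ∀ (g : Ω → ℝ), Measurable g → ∀ (Cg : ℝ), (∀ x, |g x| ≤ Cg) →
      ∀ (t : ℕ) (x : Ω), |(kop κ)^[t] g x - ∫ y, g y ∂π| ≤ 2 * Cg * (A * ρ ^ t))
    (hρ0 : 0 ≤ ρ) (hρ1 : ρ < 1)
    {f : Ω → ℝ} (hf : Measurable f) {C : ℝ} (hC : ∀ x, |f x| ≤ C)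
    {h : Ω → ℝ} (hh : Measurable h) {Ch : ℝ} (hCh : ∀ x, |h x| ≤ Ch)
    (hpois : ∀ y, h y - kop κ h y = f y - ∫ z, f z ∂π)
    (hσ : (∫ y, (f y - ∫ z, f z ∂π) ^ 2 ∂π)
        + 2 * ∑' k, ∫ y, (f y - ∫ z, f z ∂π) * (kop κ)^[k + 1] (fun y => f y - ∫ z, f z ∂π) y ∂π
        = 0) :
    ∀ᵐ x ∂(Kernel.trajMeasure (X := fun _ : ℕ => Ω) π
        (fun n : ℕ => κ.comap (fun h : (i : ↥(Finset.Iic n)) → Ω => h ⟨n, Finset.mem_Iic.2 le_rfl⟩)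
          (measurable_pi_apply _))),
      ∀ t : ℕ, h (x (t + 1)) = kop κ h (x t) := by
  set P := Kernel.trajMeasure (X := fun _ : ℕ => Ω) π
      (fun n : ℕ => κ.comap (fun h : (i : ↥(Finset.Iic n)) → Ω => h ⟨n, Finset.mem_Iic.2 le_rfl⟩)
        (measurable_pi_apply _)) with hP
  rw [ae_all_iff]
  intro t
  have hDm : Measurable fun x : ℕ → Ω => h (x (t + 1)) - kop κ h (x t) :=
    (hh.comp (measurable_pi_apply _)).sub ((measurable_kop κ hh).comp (measurable_pi_apply _))
  have hDb : ∀ x : ℕ → Ω, |h (x (t + 1)) - kop κ h (x t)| ≤ Ch + Ch := fun x =>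
    (abs_sub _ _).trans (add_le_add (hCh _) (abs_kop_le κ hCh _))
  have hi : Integrable (fun x : ℕ → Ω => (h (x (t + 1)) - kop κ h (x t)) ^ 2) P :=
    integrable_of_bounded P (hDm.pow_const 2) (C := (Ch + Ch) ^ 2) fun x => by
      rw [abs_pow]; exact pow_le_pow_left₀ (abs_nonneg _) (hDb x) 2
  have h0 : ∫ x, (h (x (t + 1)) - kop κ h (x t)) ^ 2 ∂P = 0 := by
    rw [hP, chain_incrementSq_eq_greenKubo_of_envelope hπ henv hρ0 hρ1 hf hC hh hCh hpois t, hσ]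
  have hae := (integral_eq_zero_iff_of_nonneg (fun x => sq_nonneg _) hi).1 h0
  exact hae.mono fun x hx => sub_eq_zero.1 (pow_eq_zero_iff two_ne_zero |>.1 hx)

/-- **`σ²_f = 0 ⇒` EVERY CENTRED BLOCK SUM TELESCOPES `P_π`-a.s.**, simultaneously for all `s, n`:
`Σ_{t<n} (f(X_{s+t}) − πf) = h(X_s) − h(X_{s+n})`. -/
theorem chain_blockSum_ae_eq_of_greenKubo_eq_zero (hπ : Kernel.Invariant κ π)
    (henv : ∀ (g : Ω → ℝ), Measurable g → ∀ (Cg : ℝ), (∀ x, |g x| ≤ Cg) →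
      ∀ (t : ℕ) (x : Ω), |(kop κ)^[t] g x - ∫ y, g y ∂π| ≤ 2 * Cg * (A * ρ ^ t))
    (hρ0 : 0 ≤ ρ) (hρ1 : ρ < 1)
    {f : Ω → ℝ} (hf : Measurable f) {C : ℝ} (hC : ∀ x, |f x| ≤ C)
    {h : Ω → ℝ} (hh : Measurable h) {Ch : ℝ} (hCh : ∀ x, |h x| ≤ Ch)
    (hpois : ∀ y, h y - kop κ h y = f y - ∫ z, f z ∂π)
    (hσ : (∫ y, (f y - ∫ z, f z ∂π) ^ 2 ∂π)
        + 2 * ∑' k, ∫ y, (f y - ∫ z, f z ∂π) * (kop κ)^[k + 1] (fun y => f y - ∫ z, f z ∂π) y ∂π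
        = 0) :
    ∀ᵐ x ∂(Kernel.trajMeasure (X := fun _ : ℕ => Ω) π
        (fun n : ℕ => κ.comap (fun h : (i : ↥(Finset.Iic n)) → Ω => h ⟨n, Finset.mem_Iic.2 le_rfl⟩)
          (measurable_pi_apply _))),
      ∀ s n : ℕ, ∑ t ∈ Finset.range n, (f (x (s + t)) - ∫ z, f z ∂π) = h (x s) - h (x (s + n)) := by
  filter_upwards [chain_increment_ae_eq_zero_of_greenKubo_eq_zero hπ henv hρ0 hρ1 hf hC hh hCh
    hpois hσ] with x hx
  intro s n
  rw [blockSum_eq_blockMartingale_add (kop κ) hpois s n x]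
  have hM : ∑ t ∈ Finset.range n, (h (x (s + t + 1)) - kop κ h (x (s + t))) = 0 :=
    Finset.sum_eq_zero fun t _ => by rw [hx (s + t), sub_self]
  rw [hM, zero_add]

/-- **`σ²_f = 0 ⇒` THE CENTRED PARTIAL SUMS STAY BOUNDED FOREVER, `P_π`-a.s.**: with the envelope's
own Poisson solution (`|h| ≤ 4CA/(1−ρ)`), `∀ᵐ x ∂P_π, ∀ s n, |Σ_{t<n} (f(x(s+t)) − πf)| ≤ 8CA/(1−ρ)`. -/
theorem chain_blockSum_abs_le_ae_of_greenKubo_eq_zero (hπ : Kernel.Invariant κ π)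
    (henv : ∀ (g : Ω → ℝ), Measurable g → ∀ (Cg : ℝ), (∀ x, |g x| ≤ Cg) →
      ∀ (t : ℕ) (x : Ω), |(kop κ)^[t] g x - ∫ y, g y ∂π| ≤ 2 * Cg * (A * ρ ^ t))
    (hρ0 : 0 ≤ ρ) (hρ1 : ρ < 1)
    {f : Ω → ℝ} (hf : Measurable f) {C : ℝ} (hC : ∀ x, |f x| ≤ C)
    (hσ : (∫ y, (f y - ∫ z, f z ∂π) ^ 2 ∂π)
        + 2 * ∑' k, ∫ y, (f y - ∫ z, f z ∂π) * (kop κ)^[k + 1] (fun y => f y - ∫ z, f z ∂π) y ∂π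
        = 0) :
    ∀ᵐ x ∂(Kernel.trajMeasure (X := fun _ : ℕ => Ω) π
        (fun n : ℕ => κ.comap (fun h : (i : ↥(Finset.Iic n)) → Ω => h ⟨n, Finset.mem_Iic.2 le_rfl⟩)
          (measurable_pi_apply _))),
      ∀ s n : ℕ, |∑ t ∈ Finset.range n, (f (x (s + t)) - ∫ z, f z ∂π)| ≤ 8 * C * A / (1 - ρ) := by
  obtain ⟨h, hh, hCh, hpois⟩ := poisson_exists_of_geometricEnvelope henv hρ0 hρ1 hf hC
  filter_upwards [chain_blockSum_ae_eq_of_greenKubo_eq_zero hπ henv hρ0 hρ1 hf hC hh hCh hpois hσ]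
    with x hx
  intro s n
  rw [hx s n]
  calc |h (x s) - h (x (s + n))| ≤ |h (x s)| + |h (x (s + n))| := abs_sub _ _
    _ ≤ 4 * C * A / (1 - ρ) + 4 * C * A / (1 - ρ) := add_le_add (hCh _) (hCh _)
    _ = 8 * C * A / (1 - ρ) := by ring

/-! ### `σ²_f = 0`: uniformly bounded second moments from ANY start -/

/-- **`σ²_f = 0 ⇒ E_{μ₀}[M_{s,n}²] ≤ 2 C_h² A ρ^s/(1−ρ)`** for every initial law, every block position
`s` and EVERY block length `n`: the block martingale of the Poisson solution is negligible. -/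
theorem chain_blockMartingale_sq_le_of_greenKubo_eq_zero (hπ : Kernel.Invariant κ π)
    (henv : ∀ (g : Ω → ℝ), Measurable g → ∀ (Cg : ℝ), (∀ x, |g x| ≤ Cg) →
      ∀ (t : ℕ) (x : Ω), |(kop κ)^[t] g x - ∫ y, g y ∂π| ≤ 2 * Cg * (A * ρ ^ t))
    (hρ0 : 0 ≤ ρ) (hρ1 : ρ < 1)
    {f : Ω → ℝ} (hf : Measurable f) {C : ℝ} (hC : ∀ x, |f x| ≤ C)
    {h : Ω → ℝ} (hh : Measurable h) {Ch : ℝ} (hCh : ∀ x, |h x| ≤ Ch)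
    (hpois : ∀ y, h y - kop κ h y = f y - ∫ z, f z ∂π)
    (hσ : (∫ y, (f y - ∫ z, f z ∂π) ^ 2 ∂π)
        + 2 * ∑' k, ∫ y, (f y - ∫ z, f z ∂π) * (kop κ)^[k + 1] (fun y => f y - ∫ z, f z ∂π) y ∂π
        = 0)
    (μ₀ : Measure Ω) [IsProbabilityMeasure μ₀] (s n : ℕ) :
    ∫ x, (∑ t ∈ Finset.range n, (h (x (s + t + 1)) - kop κ h (x (s + t)))) ^ 2
        ∂(Kernel.trajMeasure (X := fun _ : ℕ => Ω) μ₀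
          (fun n : ℕ => κ.comap (fun h : (i : ↥(Finset.Iic n)) → Ω => h ⟨n, Finset.mem_Iic.2 le_rfl⟩)
            (measurable_pi_apply _)))
      ≤ 2 * Ch ^ 2 * A * ρ ^ s / (1 - ρ) := by
  rw [chain_blockMartingale_sq_eq κ μ₀ hh hCh s n]
  have h1ρ : 0 < 1 - ρ := sub_pos.2 hρ1
  -- each term is an increment second moment `≤ σ²_f + 2 C_h² A ρ^{s+t} = 2 C_h² A ρ^{s+t}`
  have hterm : ∀ t ∈ Finset.range n,
      ∫ x, (kop κ (fun y => h y ^ 2) (x (s + t)) - (kop κ h (x (s + t))) ^ 2)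
          ∂(Kernel.trajMeasure (X := fun _ : ℕ => Ω) μ₀
            (fun n : ℕ => κ.comap (fun h : (i : ↥(Finset.Iic n)) → Ω => h ⟨n, Finset.mem_Iic.2 le_rfl⟩)
              (measurable_pi_apply _)))
        ≤ 2 * Ch ^ 2 * A * ρ ^ s * ρ ^ t := by
    intro t _
    have key := abs_chain_incrementSq_sub_greenKubo_le_of_envelope hπ henv hρ0 hρ1 hf hC hh hCh hpois
      μ₀ (s + t)
    rw [hσ, sub_zero] at key
    have key' := (le_abs_self _).trans key
    have e := chain_increment_sq κ μ₀ (s + t) (G := fun _ => (1 : ℝ)) measurable_const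
      ((dependsOn_const (1 : ℝ)).mono (Set.empty_subset _)) (CG := 1) (fun _ => by simp) hh hCh
    simp only [one_mul] at e
    rw [← e]
    calc _ ≤ 2 * Ch ^ 2 * (A * ρ ^ (s + t)) := key'
      _ = 2 * Ch ^ 2 * A * ρ ^ s * ρ ^ t := by rw [pow_add]; ring
  have hA : 0 ≤ 2 * Ch ^ 2 * A * ρ ^ s := by
    -- `0 ≤ A` is not assumed: read it off the increment bound at time `s` (an absolute value)
    have key := abs_chain_incrementSq_sub_greenKubo_le_of_envelope hπ henv hρ0 hρ1 hf hC hh hCh hpois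
      μ₀ s
    have : 0 ≤ 2 * Ch ^ 2 * (A * ρ ^ s) := (abs_nonneg _).trans key
    linarith
  have hgeo : ∑ t ∈ Finset.range n, ρ ^ t ≤ (1 - ρ)⁻¹ :=
    (sum_le_hasSum _ (fun t _ => pow_nonneg hρ0 t)
      (summable_geometric_of_lt_one hρ0 hρ1).hasSum).trans_eq (tsum_geometric_of_lt_one hρ0 hρ1)
  calc ∑ t ∈ Finset.range n, ∫ x, (kop κ (fun y => h y ^ 2) (x (s + t)) - (kop κ h (x (s + t))) ^ 2)
          ∂(Kernel.trajMeasure (X := fun _ : ℕ => Ω) μ₀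
            (fun n : ℕ => κ.comap (fun h : (i : ↥(Finset.Iic n)) → Ω => h ⟨n, Finset.mem_Iic.2 le_rfl⟩)
              (measurable_pi_apply _)))
      ≤ ∑ t ∈ Finset.range n, 2 * Ch ^ 2 * A * ρ ^ s * ρ ^ t := Finset.sum_le_sum hterm
    _ = 2 * Ch ^ 2 * A * ρ ^ s * ∑ t ∈ Finset.range n, ρ ^ t := by rw [Finset.mul_sum]
    _ ≤ 2 * Ch ^ 2 * A * ρ ^ s * (1 - ρ)⁻¹ := mul_le_mul_of_nonneg_left hgeo hA
    _ = 2 * Ch ^ 2 * A * ρ ^ s / (1 - ρ) := by rw [div_eq_mul_inv]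

end Envelope

end Summit.Ventures.LatticeQCDFlow.Scoring

end
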